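import Summits.KontsevichZagierPeriods.Zeta5Search.Certificates.ModRedLNKKernelGrid
import Summits.KontsevichZagierPeriods.Zeta5Search.Certificates.ModRedLK3
import Summits.KontsevichZagierPeriods.Zeta5Search.SymmetricFamilyInnerSum
import HarnessLib

/-!
# ζ(5) search — brown9 LEVEL 2 (L-NK): the termwise creative-telescoping identity (cell `pub-zeta5`, certifier `cert-2`)

HONEST FRAMING: systematic search; no irrationality claim unless certified.

From the kernel-checked coordinate sum `LNK_csum_zero` (module reduction WITHOUT multipliers, grid form, `ModRedLNKKernelGrid`)
we re-attach units and denominators and obtain the ttrl2 lane's termwise identity for the `n`-SHIFT relation (L-NK) of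
the triple sum `L(n,x) = Σ_k sL(n,x,k)` (`sL` as in `ModRedLK3`): for `n ≥ 2`, `x ∉ ℤ`, `k + 2 ≤ n`,
`12η₁₀ sL(n+1,x,k) + 12η₀₀ sL(n,x,k) + 12η₀₁ sL(n,x+1,k) + 12η₀₂ sL(n,x+2,k) = gM(n,x,k+1) − gM(n,x,k)` (`LNK_termwise`),
`gM = (−1)^k C(n,k)·SM/ddenM`, `SM = Σ_ab 12Ψ_ab·T(n;p+a,q₁)T(n;p+b,q₂)`, `ddenM = (k+1)(n−k)(n−k+1)²(x+k−2n)²(x+k−2n+1)²(x+k−2n−2)²`.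
(cert-2 g3 draft, restructured by cert-1 g3: the 17/18-factor clearing products are NEVER expanded by `ring` — they are
regrouped by `fprod_perm`/`fprod_append` into the atoms `ddenM(k)`, `ddenM(k+1)`, `PF0`, `QM` (≤ 10 linear factors each),
and the final `linear_combination` sees only these atoms.)
-/

noncomputable section

namespace Summit.KontsevichZagierPeriods.Zeta5Search.Certificates

namespace VIMInner.ModRed

open Summit.KontsevichZagierPeriods.Zeta5Search.PolyReflect

/-- The (L-NK) certificate denominator `(k+1)(n−k)(n−k+1)²(x+k−2n)²(x+k−2n+1)²(x+k−2n−2)²` (`n − p = x + k − 2n`). -/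
def ddenM (n : ℕ) (x : ℚ) (k : ℕ) : ℚ :=
  ((k : ℚ) + 1) * ((n : ℚ) - k) * (((n : ℚ) - k + 1) ^ 2 * (x + k - 2 * n) ^ 2 * (x + k - 2 * n + 1) ^ 2 * (x + k - 2 * n - 2) ^ 2)

/-- The module part of the (L-NK) certificate (data ×12): `SM = Σ_ab 12Ψ_ab(n,x,k)·T(n;p+a,q₁)·T(n;p+b,q₂)`. -/
def SM (n : ℕ) (x : ℚ) (k : ℕ) : ℚ :=
  ev3 PsiM00 n x k * (T n (3 * (n : ℚ) - x - k) (3 * (n : ℚ) - x) * T n (3 * (n : ℚ) - x - k) (2 * (n : ℚ) - k))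
  + ev3 PsiM01 n x k * (T n (3 * (n : ℚ) - x - k) (3 * (n : ℚ) - x) * T n (3 * (n : ℚ) - x - k + 1) (2 * (n : ℚ) - k))
  + ev3 PsiM10 n x k * (T n (3 * (n : ℚ) - x - k + 1) (3 * (n : ℚ) - x) * T n (3 * (n : ℚ) - x - k) (2 * (n : ℚ) - k))
  + ev3 PsiM11 n x k * (T n (3 * (n : ℚ) - x - k + 1) (3 * (n : ℚ) - x) * T n (3 * (n : ℚ) - x - k + 1) (2 * (n : ℚ) - k))

/-- The (L-NK) certificate `gM(n,x,k) = (−1)^k C(n,k) · SM(n,x,k) / ddenM(n,x,k)` (×12). -/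
def gM (n : ℕ) (x : ℚ) (k : ℕ) : ℚ := (-1) ^ k * (n.choose k : ℚ) * SM n x k / ddenM n x k

/-- Shift consistency of the data: `PsiM00S(n,x,k) = 12Ψ_00(n,x,k+1)` (kernel identity check). -/
theorem PsiM00S_eq (w x k : ℚ) : ev3 PsiM00S w x k = ev3 PsiM00 w x (k + 1) := by
  rw [← ev3_shift3]; exact ev3_eq_of_isZero3_sub3 _ _ (by decide +kernel) w x k

/-- Shift consistency of the data: `PsiM01S(n,x,k) = 12Ψ_01(n,x,k+1)` (kernel identity check). -/
theorem PsiM01S_eq (w x k : ℚ) : ev3 PsiM01S w x k = ev3 PsiM01 w x (k + 1) := by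
  rw [← ev3_shift3]; exact ev3_eq_of_isZero3_sub3 _ _ (by decide +kernel) w x k

/-- Shift consistency of the data: `PsiM10S(n,x,k) = 12Ψ_10(n,x,k+1)` (kernel identity check). -/
theorem PsiM10S_eq (w x k : ℚ) : ev3 PsiM10S w x k = ev3 PsiM10 w x (k + 1) := by
  rw [← ev3_shift3]; exact ev3_eq_of_isZero3_sub3 _ _ (by decide +kernel) w x k

/-- Shift consistency of the data: `PsiM11S(n,x,k) = 12Ψ_11(n,x,k+1)` (kernel identity check). -/
theorem PsiM11S_eq (w x k : ℚ) : ev3 PsiM11S w x k = ev3 PsiM11 w x (k + 1) := by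
  rw [← ev3_shift3]; exact ev3_eq_of_isZero3_sub3 _ _ (by decide +kernel) w x k

/-- Value of a tabulated pair symbol at levels `(n+i₁, n+i₂)` with prescribed (ring-equal) argument forms. -/
theorem TvL_val' {tab : List (ℕ × ℤ × ℤ × ℕ × ℤ × ℤ)} {n : ℕ} {x : ℚ} {k s : ℕ} {i₁ i₂ : ℕ} {j₁ l₁ j₂ l₂ : ℤ}
    (h : tab[s]? = some (i₁, j₁, l₁, i₂, j₂, l₂)) (a b c d : ℚ) (ha : a = 3 * (n : ℚ) - x - k + j₁)
    (hb : b = 3 * (n : ℚ) - x + l₁) (hc : c = 3 * (n : ℚ) - x - k + j₂) (hd : d = 2 * (n : ℚ) - k + l₂) :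
    TvL tab n x k s = T (n + i₁) a b * T (n + i₂) c d := by
  subst ha hb hc hd; simpa using TvL_of_eq h

/-- `PF0 = (k+2)(n−k−1)(n−k)(n−P+2)²(n−P−1)²` (`n − P = x + k − 2n`): `M = PF0 · ddenM(k)`. -/
def PF0 (n : ℕ) (x : ℚ) (k : ℕ) : ℚ := ((k : ℚ) + 2) * ((n : ℚ) - (k : ℚ) - 1) * ((n : ℚ) - (k : ℚ)) * (-2 * (n : ℚ) + x + (k : ℚ) + 2) * (-2 * (n : ℚ) + x + (k : ℚ) + 2) * (-2 * (n : ℚ) + x + (k : ℚ) - 1) * (-2 * (n : ℚ) + x + (k : ℚ) - 1)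

/-- `QM = (n−k+1)²(n−P)²(n−P−2)²`: `M = (k+1) · QM · ddenM(k+1)`. -/
def QM (n : ℕ) (x : ℚ) (k : ℕ) : ℚ := ((n : ℚ) - k + 1) ^ 2 * (-2 * (n : ℚ) + x + (k : ℚ)) ^ 2 * (-2 * (n : ℚ) + x + (k : ℚ) - 2) ^ 2

/-- `ddenM(k)` as a factor product over `ftM`. -/
theorem fprod_dden0 (n : ℕ) (x : ℚ) (k : ℕ) : fprod ftM [27, 24, 4, 4, 30, 30, 31, 31, 34, 34] n x k = ddenM n x k := by
  simp [fprod, ftM, linVal, ddenM]; ring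

/-- `ddenM(k+1)` as a factor product over `ftM` (forms shifted in `k`). -/
theorem fprod_dden1 (n : ℕ) (x : ℚ) (k : ℕ) : fprod ftM [28, 29, 24, 24, 31, 31, 32, 32, 33, 33] n x k = ddenM n x (k + 1) := by
  simp [fprod, ftM, linVal, ddenM]; ring

/-- `PF0` as a factor product over `ftM`. -/
theorem fprod_PF0 (n : ℕ) (x : ℚ) (k : ℕ) : fprod ftM [28, 29, 24, 32, 32, 33, 33] n x k = PF0 n x k := by
  simp [fprod, ftM, linVal, PF0]; ring

/-- `QM` as a factor product over `ftM`. -/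
theorem fprod_QM (n : ℕ) (x : ℚ) (k : ℕ) : fprod ftM [4, 4, 30, 30, 34, 34] n x k = QM n x k := by
  simp [fprod, ftM, linVal, QM]; ring

/-- Single factors. -/
theorem fprod_f2 (n : ℕ) (x : ℚ) (k : ℕ) : fprod ftM [2] n x k = (n : ℚ) + 1 := by
  simp [fprod, ftM, linVal]

/-- Single factors. -/
theorem fprod_f4 (n : ℕ) (x : ℚ) (k : ℕ) : fprod ftM [4] n x k = (n : ℚ) - k + 1 := by
  simp [fprod, ftM, linVal]; ring

/-- Single factors. -/
theorem fprod_f27 (n : ℕ) (x : ℚ) (k : ℕ) : fprod ftM [27] n x k = (k : ℚ) + 1 := by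
  simp [fprod, ftM, linVal]

/-- Single factors. -/
theorem fprod_f24_4 (n : ℕ) (x : ℚ) (k : ℕ) : fprod ftM [24, 4] n x k = ((n : ℚ) - k) * ((n : ℚ) - k + 1) := by
  simp [fprod, ftM, linVal]; ring

/-- The clearing product of the `η₁₀`-term, regrouped (no expansion): `ddenM(k) · PF0 · (n+1)`. -/
theorem fprod_M10 (n : ℕ) (x : ℚ) (k : ℕ) : fprod ftM [27, 28, 29, 24, 24, 4, 4, 30, 30, 31, 31, 32, 32, 33, 33, 34, 34, 2] n x k
    = ddenM n x k * PF0 n x k * ((n : ℚ) + 1) := by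
  rw [fprod_perm ftM n x k (show List.Perm [27, 28, 29, 24, 24, 4, 4, 30, 30, 31, 31, 32, 32, 33, 33, 34, 34, 2]
    ([27, 24, 4, 4, 30, 30, 31, 31, 34, 34] ++ [28, 29, 24, 32, 32, 33, 33] ++ [2]) by decide),
    fprod_append, fprod_append, fprod_dden0, fprod_PF0, fprod_f2]

/-- The clearing product of the `η₀ⱼ`-terms, regrouped: `ddenM(k) · PF0 · (n−k+1)`. -/
theorem fprod_M0 (n : ℕ) (x : ℚ) (k : ℕ) : fprod ftM [27, 28, 29, 24, 24, 4, 4, 30, 30, 31, 31, 32, 32, 33, 33, 34, 34, 4] n x k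
    = ddenM n x k * PF0 n x k * ((n : ℚ) - k + 1) := by
  rw [fprod_perm ftM n x k (show List.Perm [27, 28, 29, 24, 24, 4, 4, 30, 30, 31, 31, 32, 32, 33, 33, 34, 34, 4]
    ([27, 24, 4, 4, 30, 30, 31, 31, 34, 34] ++ [28, 29, 24, 32, 32, 33, 33] ++ [4]) by decide),
    fprod_append, fprod_append, fprod_dden0, fprod_PF0, fprod_f4]

/-- The clearing product of the `Ψ(k)`-terms, regrouped: `PF0 · (n−k+1)`. -/
theorem fprod_MP (n : ℕ) (x : ℚ) (k : ℕ) : fprod ftM [28, 29, 24, 32, 32, 33, 33, 4] n x k = PF0 n x k * ((n : ℚ) - k + 1) := by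
  rw [show ([28, 29, 24, 32, 32, 33, 33, 4] : List ℕ) = [28, 29, 24, 32, 32, 33, 33] ++ [4] from rfl, fprod_append, fprod_PF0,
    fprod_f4]

/-- The clearing product of the `Ψ(k+1)`-terms, regrouped: `(n−k)(n−k+1) · QM`. -/
theorem fprod_MS (n : ℕ) (x : ℚ) (k : ℕ) : fprod ftM [24, 4, 4, 4, 30, 30, 34, 34] n x k
    = ((n : ℚ) - k) * ((n : ℚ) - k + 1) * QM n x k := by
  rw [show ([24, 4, 4, 4, 30, 30, 34, 34] : List ℕ) = [24, 4] ++ [4, 4, 30, 30, 34, 34] from rfl, fprod_append, fprod_f24_4,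
    fprod_QM]

/-- The two clearings agree: `PF0 · ddenM(k) = (k+1) · QM · ddenM(k+1)` (a regrouping of the same 17 linear factors). -/
theorem PF0_dden0_eq (n : ℕ) (x : ℚ) (k : ℕ) : PF0 n x k * ddenM n x k = ((k : ℚ) + 1) * (QM n x k * ddenM n x (k + 1)) := by
  rw [← fprod_PF0, ← fprod_dden0, ← fprod_append, ← fprod_f27, ← fprod_QM, ← fprod_dden1, ← fprod_append, ← fprod_append]
  exact fprod_perm ftM n x k (by decide)

set_option maxHeartbeats 4000000 in
/-- **(L-NK) termwise** (cert-2 g3 kernel module reduction, NO multipliers; assembled by cert-1 g3): for `n ≥ 2`, `x ∉ ℤ`,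
`k + 2 ≤ n`, `12η₁₀ sL(n+1,x,k) + 12η₀₀ sL(n,x,k) + 12η₀₁ sL(n,x+1,k) + 12η₀₂ sL(n,x+2,k) = gM(n,x,k+1) − gM(n,x,k)`. -/
theorem LNK_termwise (n : ℕ) (hn : 2 ≤ n) (x : ℚ) (hx : ∀ z : ℤ, x ≠ z) (k : ℕ) (hk : k + 2 ≤ n) :
    ev2 etaM10 n x * sL (n + 1) x k + ev2 etaM00 n x * sL n x k + ev2 etaM01 n x * sL n (x + 1) k
      + ev2 etaM02 n x * sL n (x + 2) k = gM n x (k + 1) - gM n x k := by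
  have hcs := LNK_csum_zero n hn x hx k hk
  simp only [ctermSum, termsM, fprod_M10, fprod_M0, fprod_MP, fprod_MS, ev3_cons, ev3_nil, mul_zero, add_zero] at hcs
  have hX0 : TvL tabM n x k 0 = T (n + 1) (3 * ((n : ℚ) + 1) - x - k) (3 * ((n : ℚ) + 1) - x) * T (n + 1) (3 * ((n : ℚ) + 1) - x - k) (2 * ((n : ℚ) + 1) - k) :=
    TvL_val' (show tabM[0]? = some (1, 3, 3, 1, 3, 2) by rfl) _ _ _ _ (by push_cast; ring) (by push_cast; ring)
      (by push_cast; ring) (by push_cast; ring)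
  have hX1 : TvL tabM n x k 1 = T n (3 * (n : ℚ) - x - k) (3 * (n : ℚ) - x) * T n (3 * (n : ℚ) - x - k) (2 * (n : ℚ) - k) :=
    TvL_val' (show tabM[1]? = some (0, 0, 0, 0, 0, 0) by rfl) _ _ _ _ (by push_cast; ring) (by push_cast; ring)
      (by push_cast; ring) (by push_cast; ring)
  have hX2 : TvL tabM n x k 2 = T n (3 * (n : ℚ) - (x + 1) - k) (3 * (n : ℚ) - (x + 1)) * T n (3 * (n : ℚ) - (x + 1) - k) (2 * (n : ℚ) - k) :=
    TvL_val' (show tabM[2]? = some (0, -1, -1, 0, -1, 0) by rfl) _ _ _ _ (by push_cast; ring) (by push_cast; ring)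
      (by push_cast; ring) (by push_cast; ring)
  have hX3 : TvL tabM n x k 3 = T n (3 * (n : ℚ) - (x + 2) - k) (3 * (n : ℚ) - (x + 2)) * T n (3 * (n : ℚ) - (x + 2) - k) (2 * (n : ℚ) - k) :=
    TvL_val' (show tabM[3]? = some (0, -2, -2, 0, -2, 0) by rfl) _ _ _ _ (by push_cast; ring) (by push_cast; ring)
      (by push_cast; ring) (by push_cast; ring)
  have hX4 : TvL tabM n x k 4 = T n (3 * (n : ℚ) - x - ((k : ℚ) + 1)) (3 * (n : ℚ) - x) * T n (3 * (n : ℚ) - x - ((k : ℚ) + 1)) (2 * (n : ℚ) - ((k : ℚ) + 1)) :=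
    TvL_val' (show tabM[4]? = some (0, -1, 0, 0, -1, -1) by rfl) _ _ _ _ (by push_cast; ring) (by push_cast; ring)
      (by push_cast; ring) (by push_cast; ring)
  have hX5 : TvL tabM n x k 5 = T n (3 * (n : ℚ) - x - k) (3 * (n : ℚ) - x) * T n (3 * (n : ℚ) - x - k + 1) (2 * (n : ℚ) - k) :=
    TvL_val' (show tabM[5]? = some (0, 0, 0, 0, 1, 0) by rfl) _ _ _ _ (by push_cast; ring) (by push_cast; ring)
      (by push_cast; ring) (by push_cast; ring)
  have hX6 : TvL tabM n x k 6 = T n (3 * (n : ℚ) - x - ((k : ℚ) + 1)) (3 * (n : ℚ) - x) * T n (3 * (n : ℚ) - x - ((k : ℚ) + 1) + 1) (2 * (n : ℚ) - ((k : ℚ) + 1)) :=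
    TvL_val' (show tabM[6]? = some (0, -1, 0, 0, 0, -1) by rfl) _ _ _ _ (by push_cast; ring) (by push_cast; ring)
      (by push_cast; ring) (by push_cast; ring)
  have hX7 : TvL tabM n x k 7 = T n (3 * (n : ℚ) - x - k + 1) (3 * (n : ℚ) - x) * T n (3 * (n : ℚ) - x - k) (2 * (n : ℚ) - k) :=
    TvL_val' (show tabM[7]? = some (0, 1, 0, 0, 0, 0) by rfl) _ _ _ _ (by push_cast; ring) (by push_cast; ring)
      (by push_cast; ring) (by push_cast; ring)
  have hX8 : TvL tabM n x k 8 = T n (3 * (n : ℚ) - x - ((k : ℚ) + 1) + 1) (3 * (n : ℚ) - x) * T n (3 * (n : ℚ) - x - ((k : ℚ) + 1)) (2 * (n : ℚ) - ((k : ℚ) + 1)) :=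
    TvL_val' (show tabM[8]? = some (0, 0, 0, 0, -1, -1) by rfl) _ _ _ _ (by push_cast; ring) (by push_cast; ring)
      (by push_cast; ring) (by push_cast; ring)
  have hX9 : TvL tabM n x k 9 = T n (3 * (n : ℚ) - x - k + 1) (3 * (n : ℚ) - x) * T n (3 * (n : ℚ) - x - k + 1) (2 * (n : ℚ) - k) :=
    TvL_val' (show tabM[9]? = some (0, 1, 0, 0, 1, 0) by rfl) _ _ _ _ (by push_cast; ring) (by push_cast; ring)
      (by push_cast; ring) (by push_cast; ring)
  have hX10 : TvL tabM n x k 10 = T n (3 * (n : ℚ) - x - ((k : ℚ) + 1) + 1) (3 * (n : ℚ) - x) * T n (3 * (n : ℚ) - x - ((k : ℚ) + 1) + 1) (2 * (n : ℚ) - ((k : ℚ) + 1)) :=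
    TvL_val' (show tabM[10]? = some (0, 0, 0, 0, 0, -1) by rfl) _ _ _ _ (by push_cast; ring) (by push_cast; ring)
      (by push_cast; ring) (by push_cast; ring)
  rw [hX0, hX1, hX2, hX3, hX4, hX5, hX6, hX7, hX8, hX9, hX10, PsiM00S_eq, PsiM01S_eq, PsiM10S_eq, PsiM11S_eq] at hcs
  -- the module parts `SM(k)`, `SM(k+1)` as they appear in the cleared sum
  have eS0 : SM n x k = ev3 PsiM00 n x k * (T n (3 * (n : ℚ) - x - k) (3 * (n : ℚ) - x) * T n (3 * (n : ℚ) - x - k) (2 * (n : ℚ) - k))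
      + ev3 PsiM01 n x k * (T n (3 * (n : ℚ) - x - k) (3 * (n : ℚ) - x) * T n (3 * (n : ℚ) - x - k + 1) (2 * (n : ℚ) - k))
      + ev3 PsiM10 n x k * (T n (3 * (n : ℚ) - x - k + 1) (3 * (n : ℚ) - x) * T n (3 * (n : ℚ) - x - k) (2 * (n : ℚ) - k))
      + ev3 PsiM11 n x k * (T n (3 * (n : ℚ) - x - k + 1) (3 * (n : ℚ) - x) * T n (3 * (n : ℚ) - x - k + 1) (2 * (n : ℚ) - k)) := rfl
  have eS1 : SM n x (k + 1) = ev3 PsiM00 n x ((k : ℚ) + 1) * (T n (3 * (n : ℚ) - x - ((k : ℚ) + 1)) (3 * (n : ℚ) - x) * T n (3 * (n : ℚ) - x - ((k : ℚ) + 1)) (2 * (n : ℚ) - ((k : ℚ) + 1)))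
      + ev3 PsiM01 n x ((k : ℚ) + 1) * (T n (3 * (n : ℚ) - x - ((k : ℚ) + 1)) (3 * (n : ℚ) - x) * T n (3 * (n : ℚ) - x - ((k : ℚ) + 1) + 1) (2 * (n : ℚ) - ((k : ℚ) + 1)))
      + ev3 PsiM10 n x ((k : ℚ) + 1) * (T n (3 * (n : ℚ) - x - ((k : ℚ) + 1) + 1) (3 * (n : ℚ) - x) * T n (3 * (n : ℚ) - x - ((k : ℚ) + 1)) (2 * (n : ℚ) - ((k : ℚ) + 1)))
      + ev3 PsiM11 n x ((k : ℚ) + 1) * (T n (3 * (n : ℚ) - x - ((k : ℚ) + 1) + 1) (3 * (n : ℚ) - x) * T n (3 * (n : ℚ) - x - ((k : ℚ) + 1) + 1) (2 * (n : ℚ) - ((k : ℚ) + 1))) := by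
    simp only [SM, Nat.cast_add, Nat.cast_one]
  -- fold the Ψ-parts of the cleared sum into `SM(k)`, `SM(k+1)`
  have hcs' : ev2 etaM10 n x * (ddenM n x k * PF0 n x k * ((n : ℚ) + 1))
        * (T (n + 1) (3 * ((n : ℚ) + 1) - x - k) (3 * ((n : ℚ) + 1) - x) * T (n + 1) (3 * ((n : ℚ) + 1) - x - k) (2 * ((n : ℚ) + 1) - k))
      + ev2 etaM00 n x * (ddenM n x k * PF0 n x k * ((n : ℚ) - k + 1))
        * (T n (3 * (n : ℚ) - x - k) (3 * (n : ℚ) - x) * T n (3 * (n : ℚ) - x - k) (2 * (n : ℚ) - k))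
      + ev2 etaM01 n x * (ddenM n x k * PF0 n x k * ((n : ℚ) - k + 1))
        * (T n (3 * (n : ℚ) - (x + 1) - k) (3 * (n : ℚ) - (x + 1)) * T n (3 * (n : ℚ) - (x + 1) - k) (2 * (n : ℚ) - k))
      + ev2 etaM02 n x * (ddenM n x k * PF0 n x k * ((n : ℚ) - k + 1))
        * (T n (3 * (n : ℚ) - (x + 2) - k) (3 * (n : ℚ) - (x + 2)) * T n (3 * (n : ℚ) - (x + 2) - k) (2 * (n : ℚ) - k))
      + PF0 n x k * ((n : ℚ) - k + 1) * SM n x k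
      + ((n : ℚ) - k) * ((n : ℚ) - k + 1) * QM n x k * SM n x (k + 1) = 0 := by
    rw [eS0, eS1]; linear_combination hcs
  clear hcs
  -- units
  have hU : ((k : ℚ) + 1) * ((-1) ^ (k + 1) * (n.choose (k + 1) : ℚ)) = -(((n : ℚ) - k) * ((-1) ^ k * (n.choose k : ℚ))) := by
    rw [pow_succ]
    have := SymmetricRecursion.choose_succ_right_cast n k
    linear_combination (-((-1 : ℚ) ^ k)) * this
  have hC : (((n + 1).choose k : ℕ) : ℚ) * ((n : ℚ) + 1 - k) = (n.choose k : ℚ) * ((n : ℚ) + 1) := by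
    have h := Nat.choose_mul_succ_eq n k
    have h' : ((n.choose k * (n + 1) : ℕ) : ℚ) = (((n + 1).choose k * (n + 1 - k) : ℕ) : ℚ) := by rw [h]
    push_cast [Nat.cast_sub (show k ≤ n + 1 by omega)] at h'
    linarith
  -- non-vanishing
  have hk' : (k : ℚ) + 2 ≤ n := by exact_mod_cast hk
  have hx3 : x + k - 2 * n ≠ 0 := fun h => hx (2 * n - k) (by push_cast; linarith)
  have hx4 : x + k - 2 * n + 1 ≠ 0 := fun h => hx (2 * n - k - 1) (by push_cast; linarith)
  have hx5 : x + k - 2 * n + 2 ≠ 0 := fun h => hx (2 * n - k - 2) (by push_cast; linarith)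
  have hx6 : x + k - 2 * n - 1 ≠ 0 := fun h => hx (2 * n - k + 1) (by push_cast; linarith)
  have hx7 : x + k - 2 * n - 2 ≠ 0 := fun h => hx (2 * n - k + 2) (by push_cast; linarith)
  have hd0 : ddenM n x k ≠ 0 := by
    unfold ddenM
    have h1 : (k : ℚ) + 1 ≠ 0 := by positivity
    have h2 : (n : ℚ) - k ≠ 0 := by intro h; linarith
    have h2' : (n : ℚ) - k + 1 ≠ 0 := by intro h; linarith
    exact mul_ne_zero (mul_ne_zero h1 h2) (mul_ne_zero (mul_ne_zero (mul_ne_zero (pow_ne_zero _ h2') (pow_ne_zero _ hx3))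
      (pow_ne_zero _ hx4)) (pow_ne_zero _ hx7))
  have hd1 : ddenM n x (k + 1) ≠ 0 := by
    unfold ddenM
    have h1 : ((k + 1 : ℕ) : ℚ) + 1 ≠ 0 := by positivity
    have h2 : (n : ℚ) - ((k + 1 : ℕ) : ℚ) ≠ 0 := by push_cast; intro h; linarith
    have h2' : (n : ℚ) - ((k + 1 : ℕ) : ℚ) + 1 ≠ 0 := by push_cast; intro h; linarith
    have h3 : x + ((k + 1 : ℕ) : ℚ) - 2 * n ≠ 0 := fun h => hx (2 * n - k - 1) (by push_cast at h ⊢; linarith)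
    have h4 : x + ((k + 1 : ℕ) : ℚ) - 2 * n + 1 ≠ 0 := fun h => hx (2 * n - k - 2) (by push_cast at h ⊢; linarith)
    have h7 : x + ((k + 1 : ℕ) : ℚ) - 2 * n - 2 ≠ 0 := fun h => hx (2 * n - k + 1) (by push_cast at h ⊢; linarith)
    exact mul_ne_zero (mul_ne_zero h1 h2) (mul_ne_zero (mul_ne_zero (mul_ne_zero (pow_ne_zero _ h2') (pow_ne_zero _ h3))
      (pow_ne_zero _ h4)) (pow_ne_zero _ h7))
  have hF : PF0 n x k ≠ 0 := by
    unfold PF0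
    have h1' : (k : ℚ) + 2 ≠ 0 := by positivity
    have h2 : (n : ℚ) - k - 1 ≠ 0 := by intro h; linarith
    have h3 : (n : ℚ) - k ≠ 0 := by intro h; linarith
    have h7 : -2 * (n : ℚ) + x + (k : ℚ) + 2 ≠ 0 := fun h => hx5 (by linarith)
    have h8 : -2 * (n : ℚ) + x + (k : ℚ) - 1 ≠ 0 := fun h => hx6 (by linarith)
    exact mul_ne_zero (mul_ne_zero (mul_ne_zero (mul_ne_zero (mul_ne_zero (mul_ne_zero h1' h2) h3) h7) h7) h8) h8
  -- the certificate at k and k+1, cleared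
  have hg0 : ddenM n x k * gM n x k = ((-1) ^ k * (n.choose k : ℚ)) * SM n x k := by rw [gM]; field_simp
  have hg1 : ddenM n x (k + 1) * gM n x (k + 1) = ((-1) ^ (k + 1) * (n.choose (k + 1) : ℚ)) * SM n x (k + 1) := by
    rw [gM]; field_simp
  have r := PF0_dden0_eq n x k
  have hMk : ((n : ℚ) + 1 - k) * (PF0 n x k * ddenM n x k) ≠ 0 := mul_ne_zero (by intro h; linarith) (mul_ne_zero hF hd0)
  refine mul_left_cancel₀ hMk ?_
  have e10 : sL (n + 1) x k = (-1) ^ k * (((n + 1).choose k : ℕ) : ℚ) * (T (n + 1) (3 * ((n : ℚ) + 1) - x - k) (3 * ((n : ℚ) + 1) - x) * T (n + 1) (3 * ((n : ℚ) + 1) - x - k) (2 * ((n : ℚ) + 1) - k)) := by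
    rw [sL]; push_cast; ring_nf
  have e00 : sL n x k = (-1) ^ k * (n.choose k : ℚ) * (T n (3 * (n : ℚ) - x - k) (3 * (n : ℚ) - x) * T n (3 * (n : ℚ) - x - k) (2 * (n : ℚ) - k)) := rfl
  have e01 : sL n (x + 1) k = (-1) ^ k * (n.choose k : ℚ) * (T n (3 * (n : ℚ) - (x + 1) - k) (3 * (n : ℚ) - (x + 1)) * T n (3 * (n : ℚ) - (x + 1) - k) (2 * (n : ℚ) - k)) := rfl
  have e02 : sL n (x + 2) k = (-1) ^ k * (n.choose k : ℚ) * (T n (3 * (n : ℚ) - (x + 2) - k) (3 * (n : ℚ) - (x + 2)) * T n (3 * (n : ℚ) - (x + 2) - k) (2 * (n : ℚ) - k)) := rfl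
  rw [e10, e00, e01, e02]
  linear_combination (PF0 n x k * ddenM n x k * ev2 etaM10 n x * (-1) ^ k
      * (T (n + 1) (3 * ((n : ℚ) + 1) - x - k) (3 * ((n : ℚ) + 1) - x) * T (n + 1) (3 * ((n : ℚ) + 1) - x - k) (2 * ((n : ℚ) + 1) - k))) * hC
    + ((-1) ^ k * (n.choose k : ℚ)) * hcs'
    + (((n : ℚ) + 1 - k) * PF0 n x k) * hg0
    + (-(((n : ℚ) + 1 - k) * gM n x (k + 1))) * r
    + (-(((n : ℚ) + 1 - k) * ((k : ℚ) + 1) * QM n x k)) * hg1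
    + (-(((n : ℚ) + 1 - k) * QM n x k * SM n x (k + 1))) * hU

end VIMInner.ModRed

end Summit.KontsevichZagierPeriods.Zeta5Search.Certificates
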